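import Summits.QuantumFields.YangMills.Theorems.FluctuationComparisonRegPrIntLS2BetaGeodesicInterpolationSU2
import Summits.QuantumFields.YangMills.Theorems.FluctuationComparisonRegPrIntLS2BetaExpChartLipschitzOffCap
import HarnessLib

/-!
# (BG∞) ∕ `hsupp⁺` — (G7-I)ᵃᵇˢ OF UV3-NODE §116.4: THE TWO-LEG FILLING THROUGH A MIDPOINT — STAGE I OF THE 8-COLOUR GLUING WITHOUT THE LATTICE:
# two data families `φ₀ φ₁ : Z → SU(2)` over an ARBITRARY index type, a midpoint `m`, leg lengths `ℓ₁, ℓ₂ ≥ 1`; the explicit discrete filling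
# `w z k` (geodesic `φ₀ z → m` in `ℓ₁` steps, then `m → φ₁ z` in `ℓ₂` steps) has AXIAL steps `≤ π∕min(ℓ₁,ℓ₂)`, TRANSVERSE steps `≤ Λ(r)·max(dist1(φ₀ z·φ₀ z′⁻¹), dist1(φ₁ z·φ₁ z′⁻¹))`
# off the antipodal cap of `m` (`Λ(r) = (π−r)∕sin r`; factor `1` on the hemisphere), and never leaves the data's ball about `m`

Cell `ym3-torus` (YM ladder rung R3 = continuum `SU(2)` Yang–Mills on the three-torus at fixed lattice data — a RUNG: NOT d = 4, NOT infinite volume, NOT a mass gap,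
NOT Clay).  Width seat «width 5» `ym3-torus-px5` (gen 24), FREE px helper on crux `stmt-QuantumFields-20520` (`…Theses.UnitScaleTilt.FluctuationComparisonRegPrIntL`);
`--kind proof --supports stmt-QuantumFields-20520 --as helper`, count-neutral, DEFINITION-FREE (0 `def`, 0 `instance`, 0 `notation`, 0 `sorry`; default heartbeats): the leg
is the TERM `b * expPoint ((k ∕ n) • logVec (su2Quat (b⁻¹ * t)))` and the filling the TERM `if k ≤ ℓ₁ then ⟨leg φ₀ z → m⟩ else ⟨leg m → φ₁ z at k − ℓ₁⟩` in every statement.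

WHY (architect-lineage RULING «(BG∞) PLAN OF RECORD = UV3-NODE §116» 2026-09-01 00:13:02Z; INTENT (G7-I)ᵃᵇˢ 00:43:35Z).  In px19 g25's §116.3 the class-100∕010∕001 blocks (Stage I) see
prescribed data on two opposite closed faces and are filled «by two-leg geodesic interpolation along the odd axis through a midpoint `m_Q`»; with the ENGINE ROW now kernel
((G2) ✓p838762, (G3) ✓p838808, (G4) ✓p838857, (G5) ✓p838790) the Stage-I filling is a statement about an index type `Z` (the face sites), two maps `φ₀ φ₁ : Z → SU2`, and an
axial counter `k ≤ ℓ₁ + ℓ₂` — NO lattice geometry, no adjacency: the transverse bound holds for EVERY pair `z, z′`.  THIS FILE proves that statement; (G6) later names `Z`, `ℓ₁+ℓ₂`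
and the data from the block bookkeeping, and reads off §116.3's `K_I` (`d ≤ 1.84 = π − 1.3`, `Λ(1.3) = 1.91`).

WHAT IS PROVED (sorry-free; `Λ := (π − r)∕sin r`).
§1 ONE LEG `u k := b * expPoint ((k∕n) • logVec (su2Quat (b⁻¹ * t)))` (`0 < n`): `leg_zero` (`u 0 = b`), `leg_end` (`u n = t`), ★`dist1_leg_succ_le` (`dist1 (u k · (u (k+1))⁻¹) ≤ π∕n`, ALL `k`),
  ★`norm_logVec_base_inv_leg`∕`norm_logVec_end_inv_leg` (positions `(k∕n)·d`, `(1 − k∕n)·d` for `k ≤ n`), ★★`dist1_leg_commonBase_le` (targets `t t′` off the cap of the base `b`: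
  `≤ Λ·dist1 (t·t′⁻¹)` for `k ≤ n` — ✓p838790 `dist1_cone_mul_inv_cone_le`), ★★`dist1_leg_commonTarget_le` (bases `b b′` off the cap of the common target `t`: `≤ Λ·dist1 (b·b′⁻¹)` —
  ✓p838808 `interp_swap` + ✓p838790 at parameter `1 − k∕n`).
§2 TWO LEGS `w z k := if k ≤ ℓ₁ then ⟨leg φ₀ z → m, ℓ₁, k⟩ else ⟨leg m → φ₁ z, ℓ₂, k − ℓ₁⟩`: ★`fill_zero`∕`fill_mid`∕`fill_end` (`= φ₀ z`, `= m` at `k = ℓ₁`, `= φ₁ z` at `k = ℓ₁+ℓ₂`),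
  ★★★`dist1_fill_succ_le` (AXIAL: `∀ z k, dist1 (w z k · (w z (k+1))⁻¹) ≤ max (π∕ℓ₁) (π∕ℓ₂)` — the junction `k = ℓ₁` is exact: `w z ℓ₁ = m = ⟨leg 2 at 0⟩`),
  ★★★`dist1_fill_transverse_le` (TRANSVERSE, off-cap: data within arc `π − r` of `m` ⟹ `∀ z z′ k, dist1 (w z k · (w z′ k)⁻¹) ≤ Λ·max (dist1 (φ₀ z·(φ₀ z′)⁻¹)) (dist1 (φ₁ z·(φ₁ z′)⁻¹))`),
  ★★`norm_logVec_mid_inv_fill_le` (POSITION: `‖logVec (su2Quat (m⁻¹ * w z k))‖ ≤ max ‖logVec (m⁻¹ φ₀ z)‖ ‖logVec (m⁻¹ φ₁ z)‖` for `k ≤ ℓ₁+ℓ₂` — the next stage's «no cut locus» input).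

DOMAIN SENTENCE (RULING №115 R5).  Pure `SU(2)` geometry over an arbitrary index type; the off-cap hypotheses `‖logVec (m⁻¹ φᵢ z)‖ ≤ π − r` (`0 < r < π`) are explicit; nothing of the
lattice, the blocks, `hsupp⁺` itself.

HONEST SCOPE.  [folklore] spherical interpolation, assembled from the landed engine row; `hsupp⁺` ∕ (BG∞) is a CONJECTURE with a plan (§116) and numerics (FL-39), NOT proved; (G6), the
T∕S fillings, (G8) OPEN; nothing of Bałaban's renormalisation-group analysis asserted or proved ([Balaban1985RegularSpaces] (1.29) p.81 ∕ (1.36) p.82: the printed LOCAL small-bond gauges);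
`hsupp^{≥J₀}`, hD, hDBX, h3 HYPOTHESES; GAP♯∘ (registry v11 3732b7df; v12.1 adopted-in-waiting), the five registered stubs (0∕5), S2β, 20520, 19936, 19200, `YM3TorusSU2` NOT proved;
no registered stub closed; rung R3 — NOT d = 4, NOT infinite volume, NOT a mass gap, NOT Clay; the Yang–Mills mass gap is NOT proved.
-/

set_option autoImplicit false

noncomputable section

namespace Summit.QuantumFields.YangMills.Theorems.FluctuationComparisonRegPrIntLS2BetaTwoLegFilling

open scoped Real
open Literature.MathematicalPhysics.QuantumLattice (su2Quat)
open Literature.MathematicalPhysics.QuantumFieldTheory.Balaban1983to89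
open T4CubeChartGnomonic (SU2)
open T4HaarSU2ExpChart (expPoint expPoint_zero)
open T4ExpWindowSmallField (logVec norm_logVec_le_pi expPoint_logVec)
open Summit.QuantumFields.YangMills.Theorems.FluctuationComparisonRegPrIntLS2BetaGeodesicInterpolationSU2
  (interp_zero interp_one norm_logVec_inv_mul_interp norm_logVec_end_inv_mul_interp dist1_interp_step_le_pi interp_swap logVec_su2Quat_inv_eq_neg)
open Summit.QuantumFields.YangMills.Theorems.FluctuationComparisonRegPrIntLS2BetaExpChartLipschitzOffCap (dist1_cone_mul_inv_cone_le)

/-! ## §0 Parameter arithmetic of the `n` equal steps -/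

/-- `0 ≤ k∕n`. [folklore] -/
theorem div_nonneg_nat (k n : ℕ) : (0 : ℝ) ≤ (k : ℝ) / n := by positivity

/-- `k ≤ n`, `0 < n` ⟹ `k∕n ≤ 1`. [folklore] -/
theorem div_le_one_nat {k n : ℕ} (hn : 0 < n) (hk : k ≤ n) : (k : ℝ) / n ≤ 1 := by
  rw [div_le_one (by exact_mod_cast hn)]; exact_mod_cast hk

/-- Consecutive parameters differ by `1∕n`: `|k∕n − (k+1)∕n| = 1∕n`. [folklore] -/
theorem abs_div_sub_succ_div {n : ℕ} (hn : 0 < n) (k : ℕ) : |(k : ℝ) / n - ((k + 1 : ℕ) : ℝ) / n| = 1 / n := by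
  have hn' : (0 : ℝ) < n := by exact_mod_cast hn
  rw [Nat.cast_succ, show (k : ℝ) / n - ((k : ℝ) + 1) / n = -(1 / n) by field_simp; ring, abs_neg, abs_of_pos (by positivity)]

/-! ## §1 One leg: `u k = b · expPoint ((k∕n) • logVec (b⁻¹ t))` -/

/-- The leg starts at the base: `u 0 = b`. [folklore] -/
theorem leg_zero (b t : SU2) (n : ℕ) : b * expPoint ((((0 : ℕ) : ℝ) / n) • logVec (su2Quat (b⁻¹ * t))) = b := by
  rw [Nat.cast_zero, zero_div]; exact interp_zero b t

/-- The leg ends at the target: `u n = t` (`0 < n`). [folklore] -/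
theorem leg_end (b t : SU2) {n : ℕ} (hn : 0 < n) : b * expPoint ((((n : ℕ) : ℝ) / n) • logVec (su2Quat (b⁻¹ * t))) = t := by
  rw [div_self (by exact_mod_cast hn.ne')]; exact interp_one b t

/-- ★ **THE AXIAL STEP OF A LEG**: consecutive points of an `n`-step leg are within `dist1 ≤ π∕n`, whatever the endpoints (✓`dist1_interp_step_le_pi`). [folklore] -/
theorem dist1_leg_succ_le (b t : SU2) {n : ℕ} (hn : 0 < n) (k : ℕ) :
    dist1 (b * expPoint ((((k : ℕ) : ℝ) / n) • logVec (su2Quat (b⁻¹ * t))) * (b * expPoint ((((k + 1 : ℕ) : ℝ) / n) • logVec (su2Quat (b⁻¹ * t))))⁻¹) ≤ π / n := by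
  have h := dist1_interp_step_le_pi b t (((k : ℕ) : ℝ) / n) (((k + 1 : ℕ) : ℝ) / n)
  rwa [abs_div_sub_succ_div hn, one_div_mul_eq_div] at h

/-- ★ **POSITION FROM THE BASE**: `‖logVec (b⁻¹ · u k)‖ = (k∕n)·‖logVec (b⁻¹t)‖` for `k ≤ n`. [folklore] -/
theorem norm_logVec_base_inv_leg (b t : SU2) {n k : ℕ} (hn : 0 < n) (hk : k ≤ n) :
    ‖logVec (su2Quat (b⁻¹ * (b * expPoint ((((k : ℕ) : ℝ) / n) • logVec (su2Quat (b⁻¹ * t))))))‖ = (k : ℝ) / n * ‖logVec (su2Quat (b⁻¹ * t))‖ :=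
  norm_logVec_inv_mul_interp b t (div_nonneg_nat k n) (div_le_one_nat hn hk)

/-- ★ **POSITION FROM THE TARGET**: `‖logVec (t⁻¹ · u k)‖ = (1 − k∕n)·‖logVec (b⁻¹t)‖` for `k ≤ n`. [folklore] -/
theorem norm_logVec_end_inv_leg (b t : SU2) {n k : ℕ} (hn : 0 < n) (hk : k ≤ n) :
    ‖logVec (su2Quat (t⁻¹ * (b * expPoint ((((k : ℕ) : ℝ) / n) • logVec (su2Quat (b⁻¹ * t))))))‖ = (1 - (k : ℝ) / n) * ‖logVec (su2Quat (b⁻¹ * t))‖ :=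
  norm_logVec_end_inv_mul_interp b t (div_nonneg_nat k n) (div_le_one_nat hn hk)

/-- ★★ **TRANSVERSE STEP, COMMON BASE** (two legs from `b` toward `t`, `t′`, both within arc `π − r` of `b`): at every `k ≤ n` the legs are within `Λ·dist1 (t·t′⁻¹)`
(✓p838790 `dist1_cone_mul_inv_cone_le` with the factor `k∕n ≤ 1` dropped). [folklore] -/
theorem dist1_leg_commonBase_le {r : ℝ} (hr : 0 < r) (hrπ : r < π) (b t t' : SU2) (ht : ‖logVec (su2Quat (b⁻¹ * t))‖ ≤ π - r)
    (ht' : ‖logVec (su2Quat (b⁻¹ * t'))‖ ≤ π - r) {n k : ℕ} (hn : 0 < n) (hk : k ≤ n) :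
    dist1 (b * expPoint ((((k : ℕ) : ℝ) / n) • logVec (su2Quat (b⁻¹ * t))) * (b * expPoint ((((k : ℕ) : ℝ) / n) • logVec (su2Quat (b⁻¹ * t'))))⁻¹) ≤
      (π - r) / Real.sin r * dist1 (t * t'⁻¹) := by
  have h := dist1_cone_mul_inv_cone_le hr hrπ b t t' ht ht' (div_nonneg_nat k n)
  have hΛ : 0 ≤ (π - r) / Real.sin r * dist1 (t * t'⁻¹) :=
    mul_nonneg (div_nonneg (by linarith) (Real.sin_nonneg_of_nonneg_of_le_pi hr.le hrπ.le)) (GaugeGroup.dist1_nonneg _)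
  calc _ ≤ (k : ℝ) / n * ((π - r) / Real.sin r) * dist1 (t * t'⁻¹) := h
    _ = (k : ℝ) / n * ((π - r) / Real.sin r * dist1 (t * t'⁻¹)) := by ring
    _ ≤ 1 * ((π - r) / Real.sin r * dist1 (t * t'⁻¹)) := mul_le_mul_of_nonneg_right (div_le_one_nat hn hk) hΛ
    _ = _ := one_mul _

/-- ★★ **TRANSVERSE STEP, COMMON TARGET** (two legs from `b`, `b′` toward the same `t`, both bases within arc `π − r` of `t`): at every `k ≤ n` the legs are within
`Λ·dist1 (b·b′⁻¹)` (✓`interp_swap`: the leg `b → t` at `k∕n` is the leg `t → b` at `1 − k∕n`; then ✓p838790 at that parameter). [folklore] -/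
theorem dist1_leg_commonTarget_le {r : ℝ} (hr : 0 < r) (hrπ : r < π) (b b' t : SU2) (hb : ‖logVec (su2Quat (t⁻¹ * b))‖ ≤ π - r)
    (hb' : ‖logVec (su2Quat (t⁻¹ * b'))‖ ≤ π - r) {n k : ℕ} (hn : 0 < n) (hk : k ≤ n) :
    dist1 (b * expPoint ((((k : ℕ) : ℝ) / n) • logVec (su2Quat (b⁻¹ * t))) * (b' * expPoint ((((k : ℕ) : ℝ) / n) • logVec (su2Quat (b'⁻¹ * t))))⁻¹) ≤
      (π - r) / Real.sin r * dist1 (b * b'⁻¹) := by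
  rw [interp_swap t b (by linarith) (((k : ℕ) : ℝ) / n), interp_swap t b' (by linarith) (((k : ℕ) : ℝ) / n)]
  have hs : 0 ≤ 1 - (k : ℝ) / n := by linarith [div_le_one_nat hn hk]
  have h := dist1_cone_mul_inv_cone_le hr hrπ t b b' hb hb' hs
  have hΛ : 0 ≤ (π - r) / Real.sin r * dist1 (b * b'⁻¹) :=
    mul_nonneg (div_nonneg (by linarith) (Real.sin_nonneg_of_nonneg_of_le_pi hr.le hrπ.le)) (GaugeGroup.dist1_nonneg _)
  have hs1 : 1 - (k : ℝ) / n ≤ 1 := by linarith [div_nonneg_nat k n]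
  calc _ ≤ (1 - (k : ℝ) / n) * ((π - r) / Real.sin r) * dist1 (b * b'⁻¹) := h
    _ = (1 - (k : ℝ) / n) * ((π - r) / Real.sin r * dist1 (b * b'⁻¹)) := by ring
    _ ≤ 1 * ((π - r) / Real.sin r * dist1 (b * b'⁻¹)) := mul_le_mul_of_nonneg_right hs1 hΛ
    _ = _ := one_mul _

/-! ## §2 Two legs through the midpoint -/

/-- ★ The filling starts at the first family: `w z 0 = φ₀ z`. [folklore] -/
theorem fill_zero {Z : Type*} (φ₀ φ₁ : Z → SU2) (m : SU2) (ℓ₁ ℓ₂ : ℕ) (z : Z) :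
    (if (0 : ℕ) ≤ ℓ₁ then φ₀ z * expPoint ((((0 : ℕ) : ℝ) / ℓ₁) • logVec (su2Quat ((φ₀ z)⁻¹ * m)))
      else m * expPoint (((((0 : ℕ) - ℓ₁ : ℕ) : ℝ) / ℓ₂) • logVec (su2Quat (m⁻¹ * φ₁ z)))) = φ₀ z := by
  rw [if_pos (Nat.zero_le _)]; exact leg_zero _ _ _

/-- ★ The filling passes through the midpoint at `k = ℓ₁`: `w z ℓ₁ = m` (`0 < ℓ₁`). [folklore] -/
theorem fill_mid {Z : Type*} (φ₀ φ₁ : Z → SU2) (m : SU2) {ℓ₁ : ℕ} (hℓ₁ : 0 < ℓ₁) (ℓ₂ : ℕ) (z : Z) :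
    (if ℓ₁ ≤ ℓ₁ then φ₀ z * expPoint ((((ℓ₁ : ℕ) : ℝ) / ℓ₁) • logVec (su2Quat ((φ₀ z)⁻¹ * m)))
      else m * expPoint ((((ℓ₁ - ℓ₁ : ℕ) : ℝ) / ℓ₂) • logVec (su2Quat (m⁻¹ * φ₁ z)))) = m := by
  rw [if_pos le_rfl]; exact leg_end _ _ hℓ₁

/-- ★ The filling ends at the second family: `w z (ℓ₁ + ℓ₂) = φ₁ z` (`0 < ℓ₂`). [folklore] -/
theorem fill_end {Z : Type*} (φ₀ φ₁ : Z → SU2) (m : SU2) (ℓ₁ : ℕ) {ℓ₂ : ℕ} (hℓ₂ : 0 < ℓ₂) (z : Z) :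
    (if ℓ₁ + ℓ₂ ≤ ℓ₁ then φ₀ z * expPoint ((((ℓ₁ + ℓ₂ : ℕ) : ℝ) / ℓ₁) • logVec (su2Quat ((φ₀ z)⁻¹ * m)))
      else m * expPoint ((((ℓ₁ + ℓ₂ - ℓ₁ : ℕ) : ℝ) / ℓ₂) • logVec (su2Quat (m⁻¹ * φ₁ z)))) = φ₁ z := by
  rw [if_neg (by omega), Nat.add_sub_cancel_left]; exact leg_end _ _ hℓ₂

/-- ★★★ **THE AXIAL STEP OF THE TWO-LEG FILLING**: for every `z` and EVERY `k`,
`dist1 (w z k · (w z (k+1))⁻¹) ≤ max (π∕ℓ₁) (π∕ℓ₂)` (inside a leg: `π∕ℓᵢ`; at the junction `k = ℓ₁` the first leg has arrived at `m`, which is the second leg's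
start, so the step is the second leg's first step). [folklore] -/
theorem dist1_fill_succ_le {Z : Type*} (φ₀ φ₁ : Z → SU2) (m : SU2) {ℓ₁ ℓ₂ : ℕ} (hℓ₁ : 0 < ℓ₁) (hℓ₂ : 0 < ℓ₂) (z : Z) (k : ℕ) :
    dist1 ((if k ≤ ℓ₁ then φ₀ z * expPoint ((((k : ℕ) : ℝ) / ℓ₁) • logVec (su2Quat ((φ₀ z)⁻¹ * m)))
        else m * expPoint ((((k - ℓ₁ : ℕ) : ℝ) / ℓ₂) • logVec (su2Quat (m⁻¹ * φ₁ z)))) *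
      (if k + 1 ≤ ℓ₁ then φ₀ z * expPoint ((((k + 1 : ℕ) : ℝ) / ℓ₁) • logVec (su2Quat ((φ₀ z)⁻¹ * m)))
        else m * expPoint ((((k + 1 - ℓ₁ : ℕ) : ℝ) / ℓ₂) • logVec (su2Quat (m⁻¹ * φ₁ z))))⁻¹) ≤ max (π / ℓ₁) (π / ℓ₂) := by
  by_cases hk1 : k + 1 ≤ ℓ₁
  · -- both points on the first leg
    rw [if_pos (by omega), if_pos hk1]
    exact (dist1_leg_succ_le (φ₀ z) m hℓ₁ k).trans (le_max_left _ _)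
  · rw [if_neg hk1]
    by_cases hk : k ≤ ℓ₁
    · -- the junction: `k = ℓ₁`, the first point IS `m` = the second leg at `0`
      have hkeq : k = ℓ₁ := by omega
      subst hkeq
      rw [if_pos le_rfl, leg_end (φ₀ z) m hℓ₁, show k + 1 - k = 0 + 1 by omega]
      have h := dist1_leg_succ_le m (φ₁ z) hℓ₂ 0
      rw [leg_zero] at h
      exact h.trans (le_max_right _ _)
    · -- both points on the second leg
      rw [if_neg hk, show k + 1 - ℓ₁ = (k - ℓ₁) + 1 by omega]
      exact (dist1_leg_succ_le m (φ₁ z) hℓ₂ (k - ℓ₁)).trans (le_max_right _ _)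

/-- ★★★ **THE TRANSVERSE STEP OF THE TWO-LEG FILLING, OFF THE ANTIPODAL CAP OF THE MIDPOINT**: if every datum is within arc `π − r` of `m` (`0 < r < π`), then for EVERY
pair `z, z′` and every `k`, `dist1 (w z k · (w z′ k)⁻¹) ≤ ((π − r)∕sin r) · max (dist1 (φ₀ z · (φ₀ z′)⁻¹)) (dist1 (φ₁ z · (φ₁ z′)⁻¹))` — on the first leg the common
TARGET `m` controls (✓`dist1_leg_commonTarget_le`), on the second the common BASE `m` (✓`dist1_leg_commonBase_le`). [cite: Balaban1985RegularSpaces, (1.36) p.82] -/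
theorem dist1_fill_transverse_le {Z : Type*} (φ₀ φ₁ : Z → SU2) (m : SU2) {r : ℝ} (hr : 0 < r) (hrπ : r < π)
    (h₀ : ∀ z, ‖logVec (su2Quat (m⁻¹ * φ₀ z))‖ ≤ π - r) (h₁ : ∀ z, ‖logVec (su2Quat (m⁻¹ * φ₁ z))‖ ≤ π - r)
    {ℓ₁ ℓ₂ : ℕ} (hℓ₁ : 0 < ℓ₁) (hℓ₂ : 0 < ℓ₂) (z z' : Z) {k : ℕ} (hk : k ≤ ℓ₁ + ℓ₂) :
    dist1 ((if k ≤ ℓ₁ then φ₀ z * expPoint ((((k : ℕ) : ℝ) / ℓ₁) • logVec (su2Quat ((φ₀ z)⁻¹ * m)))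
        else m * expPoint ((((k - ℓ₁ : ℕ) : ℝ) / ℓ₂) • logVec (su2Quat (m⁻¹ * φ₁ z)))) *
      (if k ≤ ℓ₁ then φ₀ z' * expPoint ((((k : ℕ) : ℝ) / ℓ₁) • logVec (su2Quat ((φ₀ z')⁻¹ * m)))
        else m * expPoint ((((k - ℓ₁ : ℕ) : ℝ) / ℓ₂) • logVec (su2Quat (m⁻¹ * φ₁ z'))))⁻¹) ≤
      (π - r) / Real.sin r * max (dist1 (φ₀ z * (φ₀ z')⁻¹)) (dist1 (φ₁ z * (φ₁ z')⁻¹)) := by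
  have hΛ0 : 0 ≤ (π - r) / Real.sin r := div_nonneg (by linarith) (Real.sin_nonneg_of_nonneg_of_le_pi hr.le hrπ.le)
  by_cases hkl : k ≤ ℓ₁
  · rw [if_pos hkl, if_pos hkl]
    exact (dist1_leg_commonTarget_le hr hrπ (φ₀ z) (φ₀ z') m (h₀ z) (h₀ z') hℓ₁ hkl).trans
      (mul_le_mul_of_nonneg_left (le_max_left _ _) hΛ0)
  · rw [if_neg hkl, if_neg hkl]
    exact (dist1_leg_commonBase_le hr hrπ m (φ₁ z) (φ₁ z') (h₁ z) (h₁ z') hℓ₂ (by omega)).trans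
      (mul_le_mul_of_nonneg_left (le_max_right _ _) hΛ0)

/-- ★★ **THE FILLING STAYS IN THE DATA's BALL ABOUT THE MIDPOINT** (the «no cut locus» invariant for the next stage): for `k ≤ ℓ₁ + ℓ₂`,
`‖logVec (su2Quat (m⁻¹ * w z k))‖ ≤ max ‖logVec (su2Quat (m⁻¹ * φ₀ z))‖ ‖logVec (su2Quat (m⁻¹ * φ₁ z))‖`, provided the data are off the cut locus of `m` (`< π`, so that
the first leg's arc from `m` is the datum's). [folklore] -/
theorem norm_logVec_mid_inv_fill_le {Z : Type*} (φ₀ φ₁ : Z → SU2) (m : SU2)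
    (h₀ : ∀ z, ‖logVec (su2Quat (m⁻¹ * φ₀ z))‖ < π) {ℓ₁ ℓ₂ : ℕ} (hℓ₁ : 0 < ℓ₁) (hℓ₂ : 0 < ℓ₂) (z : Z) {k : ℕ} (hk : k ≤ ℓ₁ + ℓ₂) :
    ‖logVec (su2Quat (m⁻¹ * (if k ≤ ℓ₁ then φ₀ z * expPoint ((((k : ℕ) : ℝ) / ℓ₁) • logVec (su2Quat ((φ₀ z)⁻¹ * m)))
        else m * expPoint ((((k - ℓ₁ : ℕ) : ℝ) / ℓ₂) • logVec (su2Quat (m⁻¹ * φ₁ z))))))‖ ≤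
      max ‖logVec (su2Quat (m⁻¹ * φ₀ z))‖ ‖logVec (su2Quat (m⁻¹ * φ₁ z))‖ := by
  by_cases hkl : k ≤ ℓ₁
  · rw [if_pos hkl, norm_logVec_end_inv_leg (φ₀ z) m hℓ₁ hkl]
    -- `‖logVec ((φ₀ z)⁻¹ m)‖ = ‖logVec (m⁻¹ φ₀ z)‖` off the cut locus
    have hinv : ‖logVec (su2Quat ((φ₀ z)⁻¹ * m))‖ = ‖logVec (su2Quat (m⁻¹ * φ₀ z))‖ := by
      rw [show (φ₀ z)⁻¹ * m = (m⁻¹ * φ₀ z)⁻¹ by rw [mul_inv_rev, inv_inv], logVec_su2Quat_inv_eq_neg _ (h₀ z), norm_neg]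
    rw [hinv]
    have h1 : 0 ≤ (k : ℝ) / ℓ₁ := div_nonneg_nat k ℓ₁
    calc (1 - (k : ℝ) / ℓ₁) * ‖logVec (su2Quat (m⁻¹ * φ₀ z))‖ ≤ 1 * ‖logVec (su2Quat (m⁻¹ * φ₀ z))‖ :=
          mul_le_mul_of_nonneg_right (by linarith) (norm_nonneg _)
      _ ≤ _ := by rw [one_mul]; exact le_max_left _ _
  · rw [if_neg hkl, norm_logVec_base_inv_leg m (φ₁ z) hℓ₂ (by omega : k - ℓ₁ ≤ ℓ₂)]
    calc ((k - ℓ₁ : ℕ) : ℝ) / ℓ₂ * ‖logVec (su2Quat (m⁻¹ * φ₁ z))‖ ≤ 1 * ‖logVec (su2Quat (m⁻¹ * φ₁ z))‖ :=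
          mul_le_mul_of_nonneg_right (div_le_one_nat hℓ₂ (by omega)) (norm_nonneg _)
      _ ≤ _ := by rw [one_mul]; exact le_max_right _ _

end Summit.QuantumFields.YangMills.Theorems.FluctuationComparisonRegPrIntLS2BetaTwoLegFilling

end
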